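import Mathlib.Algebra.BigOperators.Ring.Finset
import Mathlib.Algebra.Order.BigOperators.Group.Finset
import Mathlib.Algebra.BigOperators.Field
import Mathlib.Data.Real.Basic
import Mathlib.Analysis.SpecialFunctions.Pow.Real
import HarnessLib

/-!
# Format C, design C∞ (E3, analytic side): monomial-list algebra — distribution and collection by `(tag, power)`

Route context: Fourier–Galerkin / Schur-complement certificates of Weil positivity on a window ("format C", C∞ door;
cell memo `run/shared/lean/pub/rh-explicit/rh-explicit-weil-10/KERNEL-LEVER.md` §21; supporting stmt-RiemannHypothesis-0098;
seat rh-explicit-weil-10).  `WeilFormatCCinfImageMonomials` / `WeilFormatCCinfRowMonomials` give every far object of the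
C∞ coupling column in FACTORED monomial form (products of short sums in `1/m`).  The `hM`/`hc` hypotheses of
`coupling_majorant_gram_shifted` want the COLLECTED form `ε_m Σ_f P(f)φ_f(m)` over the families
`φ_{(T,e)}(m) = T(m)/m^e`.  This file is the generic algebra in between (no analysis, no number theory):

* `imageFactored_eq_flat` — distributes the image bracket
  `A·Σ_r p_r/m^{2r+2} + Σ_k (ω_k/m^{k+1})(K_k + α_k((L/2 + g₀ + Σ_N c_N/m^N + Σ_r d_r/m^{2r+2}) − C) + β_k((s₀ + Σ_N s_N/m^N − Σ_r d'_r/m^{2r+1}) + S))`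
  into flat monomial sums `Σ coef/m^power` grouped by the tags `1`, `L` (`= log m`), `C`, `S`;
* `rowFactored_eq_flat` — the same for the row bracket `((s₀ + Σ_N s_N/m^N − Σ_r d'_r/m^{2r+1}) + S)/π · Σ_j g_j/m^{e_j} + B`;
* `sum_div_pow_eq_sum_fiber` — COLLECTION: `Σ_{x∈s} g(x)/m^{e(x)} = Σ_{d≤D} (Σ_{x∈s, e(x)=d} g(x))/m^d` (`e ≤ D` on `s`);
* `sum_sum_div_pow_eq_sum_product` — a double monomial sum as one sum over the product index set.

Elementary `Finset` algebra; standard axioms; no definitions; no RH claim.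
-/

set_option autoImplicit false
-- `Summit.RiemannHypothesis.RiemannHypothesis.…` is the layout-mandated namespace (summit = problem name).
set_option linter.dupNamespace false

open Finset
open scoped BigOperators

namespace Summit.RiemannHypothesis.RiemannHypothesis.Theorems.WeilFormatC

/-! ## Collection by power -/

/-- **Collection of a monomial list by power**: if `e(x) ≤ D` on `s`, then
`Σ_{x∈s} g(x)/m^{e(x)} = Σ_{d∈[0,D]} (Σ_{x∈s, e(x)=d} g(x))/m^d`. -/
theorem sum_div_pow_eq_sum_fiber {ι : Type*} (s : Finset ι) (g : ι → ℝ) (e : ι → ℕ) {D : ℕ}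
    (hD : ∀ x ∈ s, e x ≤ D) (m : ℝ) :
    ∑ x ∈ s, g x / m ^ (e x) = ∑ d ∈ Finset.range (D + 1), (∑ x ∈ s.filter (fun x ↦ e x = d), g x) / m ^ d := by
  rw [← Finset.sum_fiberwise_of_maps_to (s := s) (t := Finset.range (D + 1)) (g := e)
    (fun x hx ↦ Finset.mem_range.2 (Nat.lt_succ_of_le (hD x hx)))]
  refine Finset.sum_congr rfl fun d _ ↦ ?_
  rw [Finset.sum_div]
  refine Finset.sum_congr rfl fun x hx ↦ ?_
  rw [(Finset.mem_filter.1 hx).2]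

/-- A double monomial sum as one sum over the product index set:
`Σ_{x∈s} Σ_{y∈t} g(x,y)/m^{e(x,y)} = Σ_{p∈s×t} g(p.1,p.2)/m^{e(p.1,p.2)}`. -/
theorem sum_sum_div_pow_eq_sum_product {ι κ : Type*} (s : Finset ι) (t : Finset κ) (g : ι → κ → ℝ)
    (e : ι → κ → ℕ) (m : ℝ) :
    ∑ x ∈ s, ∑ y ∈ t, g x y / m ^ (e x y) = ∑ p ∈ s ×ˢ t, g p.1 p.2 / m ^ (e p.1 p.2) := by
  rw [Finset.sum_product]

/-! ## Distribution of the factored forms -/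

/-- One image term distributed: with `w = ω/m^{k+1}`,
`w(K + α((L/2 + g₀ + Σ_N c_N/m^N + Σ_r d_r/m^{2r+2}) − C) + β((s₀ + Σ_N s_N/m^N − Σ_r d'_r/m^{2r+1}) + S))`
equals the flat sum of its monomials. -/
theorem imageTerm_eq_flat (m ω w K α β L g₀ s₀ C S : ℝ) (k Kx R : ℕ) (c sN d d' : ℕ → ℝ)
    (hw : w = ω / m ^ (k + 1)) :
    w * (K + α * ((L / 2 + g₀ + ∑ N ∈ Finset.Icc 1 Kx, c N / m ^ N + ∑ r ∈ Finset.range R, d r / m ^ (2 * r + 2)) - C)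
          + β * ((s₀ + ∑ N ∈ Finset.Icc 1 Kx, sN N / m ^ N - ∑ r ∈ Finset.range R, d' r / m ^ (2 * r + 1)) + S))
      = (ω * K + ω * α * g₀ + ω * β * s₀) / m ^ (k + 1)
        + ∑ N ∈ Finset.Icc 1 Kx, (ω * α * c N) / m ^ (k + 1 + N)
        + ∑ r ∈ Finset.range R, (ω * α * d r) / m ^ (k + 1 + (2 * r + 2))
        + ∑ N ∈ Finset.Icc 1 Kx, (ω * β * sN N) / m ^ (k + 1 + N)
        - ∑ r ∈ Finset.range R, (ω * β * d' r) / m ^ (k + 1 + (2 * r + 1))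
        + L * ((ω * α / 2) / m ^ (k + 1))
        - C * ((ω * α) / m ^ (k + 1))
        + S * ((ω * β) / m ^ (k + 1)) := by
  have h1 : ∑ N ∈ Finset.Icc 1 Kx, (ω * α * c N) / m ^ (k + 1 + N)
      = ω / m ^ (k + 1) * α * ∑ N ∈ Finset.Icc 1 Kx, c N / m ^ N := by
    rw [Finset.mul_sum]; exact Finset.sum_congr rfl fun N _ ↦ by rw [pow_add]; ring
  have h2 : ∑ r ∈ Finset.range R, (ω * α * d r) / m ^ (k + 1 + (2 * r + 2))
      = ω / m ^ (k + 1) * α * ∑ r ∈ Finset.range R, d r / m ^ (2 * r + 2) := by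
    rw [Finset.mul_sum]; exact Finset.sum_congr rfl fun r _ ↦ by rw [pow_add]; ring
  have h3 : ∑ N ∈ Finset.Icc 1 Kx, (ω * β * sN N) / m ^ (k + 1 + N)
      = ω / m ^ (k + 1) * β * ∑ N ∈ Finset.Icc 1 Kx, sN N / m ^ N := by
    rw [Finset.mul_sum]; exact Finset.sum_congr rfl fun N _ ↦ by rw [pow_add]; ring
  have h4 : ∑ r ∈ Finset.range R, (ω * β * d' r) / m ^ (k + 1 + (2 * r + 1))
      = ω / m ^ (k + 1) * β * ∑ r ∈ Finset.range R, d' r / m ^ (2 * r + 1) := by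
    rw [Finset.mul_sum]; exact Finset.sum_congr rfl fun r _ ↦ by rw [pow_add]; ring
  rw [h1, h2, h3, h4, hw]
  ring

/-- **The image bracket distributed into flat monomial sums grouped by tag** (`1`, `L`, `C`, `S`): with
`w_k = ω_k/m^{k+1}`, the bracket of `abs_re/im_image_pow_sub_monomials_le` equals
`[pure] + L·Σ_k(ω_kα_k/2)/m^{k+1} − C·Σ_k(ω_kα_k)/m^{k+1} + S·Σ_k(ω_kβ_k)/m^{k+1}`. -/
theorem imageFactored_eq_flat (m A L g₀ s₀ C S : ℝ) (n J Kx R : ℕ) (p ω w K α β : ℕ → ℝ)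
    (c sN d d' : ℕ → ℝ) (hw : ∀ k, w k = ω k / m ^ (k + 1)) :
    A * (∑ r ∈ Finset.range J, p r / m ^ (2 * r + 2))
        + ∑ k ∈ Finset.range n, w k *
            (K k + α k * ((L / 2 + g₀ + ∑ N ∈ Finset.Icc 1 Kx, c N / m ^ N
                              + ∑ r ∈ Finset.range R, d r / m ^ (2 * r + 2)) - C)
                 + β k * ((s₀ + ∑ N ∈ Finset.Icc 1 Kx, sN N / m ^ N
                              - ∑ r ∈ Finset.range R, d' r / m ^ (2 * r + 1)) + S))
      = (∑ r ∈ Finset.range J, (A * p r) / m ^ (2 * r + 2)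
          + ∑ k ∈ Finset.range n, (ω k * K k + ω k * α k * g₀ + ω k * β k * s₀) / m ^ (k + 1)
          + ∑ k ∈ Finset.range n, ∑ N ∈ Finset.Icc 1 Kx, (ω k * α k * c N) / m ^ (k + 1 + N)
          + ∑ k ∈ Finset.range n, ∑ r ∈ Finset.range R, (ω k * α k * d r) / m ^ (k + 1 + (2 * r + 2))
          + ∑ k ∈ Finset.range n, ∑ N ∈ Finset.Icc 1 Kx, (ω k * β k * sN N) / m ^ (k + 1 + N)
          - ∑ k ∈ Finset.range n, ∑ r ∈ Finset.range R, (ω k * β k * d' r) / m ^ (k + 1 + (2 * r + 1)))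
        + L * ∑ k ∈ Finset.range n, (ω k * α k / 2) / m ^ (k + 1)
        - C * ∑ k ∈ Finset.range n, (ω k * α k) / m ^ (k + 1)
        + S * ∑ k ∈ Finset.range n, (ω k * β k) / m ^ (k + 1) := by
  rw [Finset.sum_congr rfl fun k _ ↦ imageTerm_eq_flat m (ω k) (w k) (K k) (α k) (β k) L g₀ s₀ C S k Kx R
    c sN d d' (hw k)]
  rw [Finset.mul_sum, Finset.mul_sum, Finset.mul_sum, Finset.mul_sum]
  simp only [Finset.sum_add_distrib, Finset.sum_sub_distrib]
  have hA : ∑ r ∈ Finset.range J, A * (p r / m ^ (2 * r + 2)) = ∑ r ∈ Finset.range J, (A * p r) / m ^ (2 * r + 2) :=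
    Finset.sum_congr rfl fun r _ ↦ by ring
  rw [hA]
  ring

/-- **The row bracket distributed** (tags `1`, `S`): with the row weights `g_j/m^{e_j}` and the `J_s`-monomials
`s₀ + Σ_N s_N/m^N − Σ_r d'_r/m^{2r+1}`,
`((J_s-monomials + S)/π)·Σ_j g_j/m^{e_j} + B = [pure] + S·Σ_j (g_j/π)/m^{e_j} + B`. -/
theorem rowFactored_eq_flat (m s₀ S B : ℝ) (J Kx R : ℕ) (g : ℕ → ℝ) (e : ℕ → ℕ) (sN d' : ℕ → ℝ) :
    ((s₀ + ∑ N ∈ Finset.Icc 1 Kx, sN N / m ^ N - ∑ r ∈ Finset.range R, d' r / m ^ (2 * r + 1)) + S) / Real.pi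
          * (∑ j ∈ Finset.range J, g j / m ^ (e j)) + B
      = (∑ j ∈ Finset.range J, (s₀ * g j / Real.pi) / m ^ (e j)
          + ∑ j ∈ Finset.range J, ∑ N ∈ Finset.Icc 1 Kx, (sN N * g j / Real.pi) / m ^ (N + e j)
          - ∑ j ∈ Finset.range J, ∑ r ∈ Finset.range R, (d' r * g j / Real.pi) / m ^ ((2 * r + 1) + e j))
        + S * ∑ j ∈ Finset.range J, (g j / Real.pi) / m ^ (e j) + B := by
  have h1 : ∑ j ∈ Finset.range J, ∑ N ∈ Finset.Icc 1 Kx, (sN N * g j / Real.pi) / m ^ (N + e j)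
      = (∑ N ∈ Finset.Icc 1 Kx, sN N / m ^ N) / Real.pi * ∑ j ∈ Finset.range J, g j / m ^ (e j) := by
    rw [Finset.sum_div, Finset.sum_mul, Finset.sum_comm]
    refine Finset.sum_congr rfl fun N _ ↦ ?_
    rw [Finset.mul_sum]
    exact Finset.sum_congr rfl fun j _ ↦ by rw [pow_add]; ring
  have h2 : ∑ j ∈ Finset.range J, ∑ r ∈ Finset.range R, (d' r * g j / Real.pi) / m ^ ((2 * r + 1) + e j)
      = (∑ r ∈ Finset.range R, d' r / m ^ (2 * r + 1)) / Real.pi * ∑ j ∈ Finset.range J, g j / m ^ (e j) := by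
    rw [Finset.sum_div, Finset.sum_mul, Finset.sum_comm]
    refine Finset.sum_congr rfl fun r _ ↦ ?_
    rw [Finset.mul_sum]
    exact Finset.sum_congr rfl fun j _ ↦ by rw [pow_add]; ring
  have h3 : ∑ j ∈ Finset.range J, (s₀ * g j / Real.pi) / m ^ (e j)
      = s₀ / Real.pi * ∑ j ∈ Finset.range J, g j / m ^ (e j) := by
    rw [Finset.mul_sum]; exact Finset.sum_congr rfl fun j _ ↦ by ring
  have h4 : ∑ j ∈ Finset.range J, (g j / Real.pi) / m ^ (e j)
      = (∑ j ∈ Finset.range J, g j / m ^ (e j)) / Real.pi := by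
    rw [Finset.sum_div]; exact Finset.sum_congr rfl fun j _ ↦ by ring
  rw [h1, h2, h3, h4]
  ring

end Summit.RiemannHypothesis.RiemannHypothesis.Theorems.WeilFormatC
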